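import Literature.Computability.Cryptography.ChenQuantumLWECheckBoxMarginals

/-!
# Digit observers of the Step-9 register, III: the box-wrap bound on EVERY parity-check box (T25)

REPRODUCTION / ANALYSIS OF A CLAIMED RESULT UNDER ADJUDICATION (withdrawn): Yilei Chen, *Quantum
Algorithms for Lattice Problems*, IACR ePrint 2024/555, version of 2024-04-18 [ChenQuantumLattice2024]
(the version carrying the author's note that Step 9 contains a bug), Step 9 (§3.5.9, pp. 34–38) acting
on the line ket `|φ8.b⟩ = Σ_{j ∈ ℤ_P} ψ_P(−j²) |2D²j·b + v′ mod N⟩` (p. 35), with the secret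
`b = [−1, 2p₁sᵀ, 2p₁eᵀ]ᵀ` of eq. (12) (p. 17), the LWE instance as the `q`-ary lattice `L_q^⊥(A)` of
§3.2–3.3 (pp. 16–18) and the Step-8 value of Claim 3.14 (pp. 33–34).  Bundle
`papers/QuantumAdvantage/lwe-quantum-autopsy/`, Part 2 (`REPAIR-CENSUS.md` §33, theorem **T25**, census
row G7), sequel of `ChenQuantumLWEBoxWrapBound.lean` (T21: `finsetDigitObserver_le`, `exitProb_le`,
`chenCheckBoxDigitObserver_le_centred`) and `ChenQuantumLWECheckBoxMarginals.lean` (T23: `boxRed`,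
`boxRep`, `apply_eq_of_boxRed_eq`, `sysCheck`).  HONEST FRAMING: kernel-checked THEOREMS about the
measurement statistics of states occurring in a WITHDRAWN algorithm — an elementary counting identity
that removes the one instance hypothesis of a no-go bound for one observer class (census row G7, items
(B2)/(B3), "digit observers"); NOT summit progress, no cryptanalytic claim in either direction, no new
algorithm; quantum lower bounds are out of scope.

## What is proved

T21 (e) (`chenCheckBoxDigitObserver_le_centred`) bounds the datum success of every instance-aware DIGIT
observer of the Step-9 register by `1/Q + Dp₁(Q² − 1)‖b‖₁/(2Qq)` under ONE hypothesis on the instance: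
uniform coordinate marginals of the parity-check box `R = L_q^⊥(A) ∩ [0,q)^{n+1}` — discharged by T23
for systematic instances whose rows generate the unit ideal of `ℤ_q`, the exceptional instances being
counted by T24.  This module shows that the hypothesis is UNNECESSARY: the same bound with the same
constant holds on EVERY parity-check box — every modulus `q ≥ 1`, every family of additive checks into
`ℤ_q` annihilating `b` — by an exact counting identity that replaces the marginal count.

**A. Wrapped translations.**  `a ↦ (a + s) mod q ∈ [0,q)^m`, written `boxRep q (boxRed q (a + s))`
with T23's residue / canonical-representative maps; coordinate `i` equals `a_i + s_i − q·⌊(a_i + s_i)/q⌋`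
(`boxRep_boxRed_add_eq_sub`); it is injective on the box (`boxRep_boxRed_add_injOn`) and equals `a + s`
when that stays in the box (T23's `boxRep_boxRed`).

**B. The floor-sum identity and the exit law** (pure counting).  If a finite `R ⊆ [0,q)^m` is mapped
INTO ITSELF by the wrapped translation by `s` (then ONTO: `image_boxRep_boxRed_add`), summing coordinate `i` over
`R` before and after the translation gives

  `q · Σ_{a ∈ R} ⌊(a_i + s_i)/q⌋ = #R · s_i`            (`mul_sum_ediv_eq_card_mul`).

All these quotients have the sign of `s_i`, each is non-zero exactly when coordinate `i` leaves `[0,q)`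
under `a ↦ a + s`, and each has absolute value `≤ 1` when `|s_i| ≤ q`; hence

  `q · #{a ∈ R : a_i + s_i ∉ [0,q)} ≤ #R · |s_i|`        (`mul_card_coordExit_le`),

with EQUALITY when `|s_i| ≤ q` (`mul_card_coordExit_eq` — the bound is the exact exit mass, not slack);
by the union bound `q · #{a ∈ R : a + s ∉ [0,q)^m} ≤ #R · ‖s‖₁`
(`mul_card_filter_add_not_mem_intBox_le_of_wrap`) and `Pr_{a uniform on R}[a + s ∉ R] ≤ ‖s‖₁ / q`
(`exitProb_le_of_wrap`) — T21's `exitProb_le` with BOTH its hypotheses (uniform marginals, closure)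
replaced by wrap-invariance (which contains closure: `closed_of_wrap`).

**C. The register.**  T21 (b)–(d) with wrap-invariance in place of marginals + closure:
`boxDigitObserver_le_of_wrap`, `chenBoxDigitObserver_le_of_wrap`, `chenBoxDigitObserver_le_centred_of_wrap`.

**D. Parity-check boxes are wrap-invariant** under every vector annihilated by the checks
(`boxRep_boxRed_add_mem_checkBox`: an additive check into `ℤ_q` only sees residues — T23's
`apply_eq_of_boxRed_eq`).  Hence **`chenCheckBoxDigitObserver_le_centred_all`**: T21 (e)'s statement
VERBATIM WITHOUT `hmarg` — for every `q ≥ 1`, every family `κ` of additive checks with `κ_j b = 0`, every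
`w₀`, every translation-invariant side information and every randomised guessing rule, the datum success
of a digit observer of a hidden vector uniform on `checkBox q κ` is `≤ 1/Q + Dp₁(Q² − 1)‖b‖₁/(2Qq)`;
and **`chenSysCheckBoxDigitObserver_le_centred_all`**: T23's `chenSysCheckBoxDigitObserver_le_centred` /
T24's `…_of_block` for Chen's systematic instances `A = [2p₁t | Uᵀ | I_m]` with NEITHER the
generating-rows hypothesis `hrow` NOR the exceptional-block hypothesis NOR injectivity of the pivots.
T21 (e), T23 (C) and T24 (D) are the special cases in which the dropped hypotheses happen to hold; the
census's exceptional set of instances (density `≤ m·Σ_{p∣q} p^{−ℓ}`, T24) is no longer excluded from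
the cap.

## What is NOT here

Lemma A of the census (the identification of the run's hidden-vector law with the uniform law on
`L_q^⊥(A) ∩ [0,q)^n`, §24.3) and the two instance inequalities that make the constant small at Chen's
sizes (§31.2 / §32.2; the algebra is T24's `cap_lt_one_iff` etc.); coherent (non-diagonal)
instance-aware measurements (census row G7's residual, G7a); any cryptanalytic claim.
-/

namespace Literature.Computability.Cryptography.Chen2024

open scoped BigOperators

/-! ### A. Wrapped translations `a ↦ (a + s) mod q` of the box `[0,q)^m` -/

section Wrap

variable {m : ℕ} (q : ℕ) [NeZero q]

/-- Coordinates of the WRAPPED translate `(a + s) mod q ∈ [0,q)^m` (canonical representatives of the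
residues of `a + s`, T23's `boxRep ∘ boxRed`): `(a_i + s_i) mod q`. [folklore] -/
theorem boxRep_boxRed_add_apply (s a : Fin m → ℤ) (i : Fin m) :
    boxRep q (boxRed q (a + s)) i = (a i + s i) % (q : ℤ) := by
  simp only [boxRep, boxRed, Pi.add_apply]
  exact ZMod.val_intCast _

/-- Floor form of the wrapped translate: `(a_i + s_i) mod q = a_i + s_i − q·⌊(a_i + s_i)/q⌋`.
[folklore] -/
theorem boxRep_boxRed_add_eq_sub (s a : Fin m → ℤ) (i : Fin m) :
    boxRep q (boxRed q (a + s)) i = a i + s i - (q : ℤ) * ((a i + s i) / (q : ℤ)) := by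
  rw [boxRep_boxRed_add_apply, Int.emod_def]

/-- The wrapped translation by `s`, `a ↦ (a + s) mod q`, is injective on the box `[0,q)^m` (it lies in
the box by `boxRep_mem_intBox`, has the residues of `a + s` by `boxRed_boxRep`, and equals `a + s` when
that stays in the box by `boxRep_boxRed`). [folklore] -/
theorem boxRep_boxRed_add_injOn (s : Fin m → ℤ) :
    Set.InjOn (fun a => boxRep q (boxRed q (a + s))) ↑(intBox m q) := by
  intro a ha a' ha' h
  have h1 : boxRed q (a + s) = boxRed q (a' + s) := by
    rw [← boxRed_boxRep q (boxRed q (a + s)), ← boxRed_boxRep q (boxRed q (a' + s))]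
    exact congrArg (boxRed q) h
  have h2 : boxRed q a = boxRed q a' := by
    rw [boxRed_add, boxRed_add] at h1
    exact add_right_cancel h1
  rw [← boxRep_boxRed q (Finset.mem_coe.1 ha), ← boxRep_boxRed q (Finset.mem_coe.1 ha'), h2]

end Wrap

/-! ### B. The floor-sum identity and the exit law of a wrap-invariant box set -/

section Exit

variable {m : ℕ} (q : ℕ) [NeZero q]

/-- A subset of the box mapped into itself by a wrapped translation is PERMUTED by it. [folklore] -/
theorem image_boxRep_boxRed_add (R : Finset (Fin m → ℤ)) (hR : R ⊆ intBox m q) (s : Fin m → ℤ)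
    (hwrap : ∀ a ∈ R, boxRep q (boxRed q (a + s)) ∈ R) :
    (R.image fun a => boxRep q (boxRed q (a + s))) = R := by
  refine Finset.eq_of_subset_of_card_le (fun x hx => ?_) (le_of_eq ?_)
  · obtain ⟨a, ha, rfl⟩ := Finset.mem_image.1 hx
    exact hwrap a ha
  · exact (Finset.card_image_of_injOn
      ((boxRep_boxRed_add_injOn q s).mono (Finset.coe_subset.2 hR))).symm

/-- **The floor-sum identity.**  If `R ⊆ [0,q)^m` is mapped into itself by the wrapped translation by
`s`, then `q · Σ_{a ∈ R} ⌊(a_i + s_i)/q⌋ = #R · s_i` for every coordinate `i` — sum coordinate `i`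
over `R` before and after the (bijective) wrapped translation. [folklore] -/
theorem mul_sum_ediv_eq_card_mul (R : Finset (Fin m → ℤ)) (hR : R ⊆ intBox m q) (s : Fin m → ℤ)
    (hwrap : ∀ a ∈ R, boxRep q (boxRed q (a + s)) ∈ R) (i : Fin m) :
    (q : ℤ) * ∑ a ∈ R, (a i + s i) / (q : ℤ) = R.card * s i := by
  have hinj : Set.InjOn (fun a => boxRep q (boxRed q (a + s))) ↑R :=
    (boxRep_boxRed_add_injOn q s).mono (Finset.coe_subset.2 hR)
  have hsum : ∑ a ∈ R, boxRep q (boxRed q (a + s)) i = ∑ a ∈ R, a i := by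
    calc ∑ a ∈ R, boxRep q (boxRed q (a + s)) i
        = ∑ x ∈ R.image (fun a => boxRep q (boxRed q (a + s))), x i :=
          (Finset.sum_image (f := fun x : Fin m → ℤ => x i) fun a ha a' ha' h => hinj ha ha' h).symm
      _ = ∑ a ∈ R, a i := by rw [image_boxRep_boxRed_add q R hR s hwrap]
  have h2 : ∑ a ∈ R, boxRep q (boxRed q (a + s)) i
      = ∑ a ∈ R, (a i + s i - (q : ℤ) * ((a i + s i) / (q : ℤ))) :=
    Finset.sum_congr rfl fun a _ => boxRep_boxRed_add_eq_sub q s a i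
  rw [hsum, Finset.sum_sub_distrib, Finset.sum_add_distrib, Finset.sum_const, nsmul_eq_mul,
    ← Finset.mul_sum] at h2
  linarith

omit [NeZero q] in
/-- In the box, the quotient `⌊(a_i + s_i)/q⌋` is `≥ 0` when `s_i ≥ 0`. [folklore] -/
theorem ediv_nonneg_of_shift_nonneg {a s : Fin m → ℤ} (ha : a ∈ intBox m q) {i : Fin m}
    (hs : 0 ≤ s i) : 0 ≤ (a i + s i) / (q : ℤ) := by
  obtain ⟨h0, _⟩ := Finset.mem_Ico.1 (mem_intBox.1 ha i)
  exact Int.ediv_nonneg (by linarith) (by positivity)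

/-- In the box, the quotient `⌊(a_i + s_i)/q⌋` is `≤ 0` when `s_i ≤ 0`. [folklore] -/
theorem ediv_nonpos_of_shift_nonpos {a s : Fin m → ℤ} (ha : a ∈ intBox m q) {i : Fin m}
    (hs : s i ≤ 0) : (a i + s i) / (q : ℤ) ≤ 0 := by
  obtain ⟨_, h1⟩ := Finset.mem_Ico.1 (mem_intBox.1 ha i)
  have hq : (0 : ℤ) < q := by exact_mod_cast Nat.pos_of_ne_zero (NeZero.ne q)
  have : (a i + s i) / (q : ℤ) < 1 := (Int.ediv_lt_iff_lt_mul hq).2 (by linarith)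
  linarith

/-- In the box, the quotient is at least `1` in size exactly on an exit: if `a_i + s_i ∉ [0,q)` then
`1 ≤ |⌊(a_i + s_i)/q⌋|`. [folklore] -/
theorem one_le_abs_ediv_of_exit {a s : Fin m → ℤ} (ha : a ∈ intBox m q) {i : Fin m}
    (hx : a i + s i ∉ Finset.Ico (0 : ℤ) q) : 1 ≤ |(a i + s i) / (q : ℤ)| := by
  obtain ⟨h0, h1⟩ := Finset.mem_Ico.1 (mem_intBox.1 ha i)
  have hq : (0 : ℤ) < q := by exact_mod_cast Nat.pos_of_ne_zero (NeZero.ne q)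
  rw [Finset.mem_Ico, not_and_or, not_le, not_lt] at hx
  rcases hx with hx | hx
  · have hneg : (a i + s i) / (q : ℤ) < 0 := (Int.ediv_lt_iff_lt_mul hq).2 (by linarith)
    rw [abs_of_neg hneg]
    linarith
  · have hone : 1 ≤ (a i + s i) / (q : ℤ) := (Int.le_ediv_iff_mul_le hq).2 (by linarith)
    rwa [abs_of_pos (by linarith)]

omit [NeZero q] in
/-- No exit, no quotient: if `a_i + s_i ∈ [0,q)` then `⌊(a_i + s_i)/q⌋ = 0`. [folklore] -/
theorem ediv_eq_zero_of_stay {a s : Fin m → ℤ} {i : Fin m} (hx : a i + s i ∈ Finset.Ico (0 : ℤ) q) :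
    (a i + s i) / (q : ℤ) = 0 := by
  obtain ⟨h0, h1⟩ := Finset.mem_Ico.1 hx
  exact Int.ediv_eq_zero_of_lt h0 h1

/-- Small shifts wrap at most once: in the box, `|s_i| ≤ q` gives `|⌊(a_i + s_i)/q⌋| ≤ 1`. [folklore] -/
theorem abs_ediv_le_one_of_small {a s : Fin m → ℤ} (ha : a ∈ intBox m q) {i : Fin m}
    (hs : (s i).natAbs ≤ q) : |(a i + s i) / (q : ℤ)| ≤ 1 := by
  obtain ⟨h0, h1⟩ := Finset.mem_Ico.1 (mem_intBox.1 ha i)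
  have hq : (0 : ℤ) < q := by exact_mod_cast Nat.pos_of_ne_zero (NeZero.ne q)
  have hs' : |s i| ≤ (q : ℤ) := by
    rw [← Int.natCast_natAbs]
    exact_mod_cast hs
  obtain ⟨hs1, hs2⟩ := abs_le.1 hs'
  rw [abs_le]
  refine ⟨(Int.le_ediv_iff_mul_le hq).2 (by linarith), ?_⟩
  have : (a i + s i) / (q : ℤ) < 2 := (Int.ediv_lt_iff_lt_mul hq).2 (by linarith)
  linarith

/-- The quotients counted in size: `q · Σ_{a ∈ R} |⌊(a_i + s_i)/q⌋| = #R · |s_i|` for a wrap-invariant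
`R` (constant sign + the floor-sum identity). [folklore] -/
theorem mul_sum_abs_ediv_eq (R : Finset (Fin m → ℤ)) (hR : R ⊆ intBox m q) (s : Fin m → ℤ)
    (hwrap : ∀ a ∈ R, boxRep q (boxRed q (a + s)) ∈ R) (i : Fin m) :
    (q : ℤ) * ∑ a ∈ R, |(a i + s i) / (q : ℤ)| = R.card * |s i| := by
  have key := mul_sum_ediv_eq_card_mul q R hR s hwrap i
  rcases le_total 0 (s i) with hs | hs
  · rw [abs_of_nonneg hs,
      Finset.sum_congr rfl fun a ha => abs_of_nonneg (ediv_nonneg_of_shift_nonneg q (hR ha) hs), key]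
  · rw [abs_of_nonpos hs,
      Finset.sum_congr rfl fun a ha => abs_of_nonpos (ediv_nonpos_of_shift_nonpos q (hR ha) hs),
      Finset.sum_neg_distrib, mul_neg, key, mul_neg]

/-- Exits are counted by the quotients: `#{a ∈ R : a_i + s_i ∉ [0,q)} ≤ Σ_{a ∈ R} |⌊(a_i + s_i)/q⌋|`
for any `R` in the box. [folklore] -/
theorem card_coordExit_le_sum_abs_ediv (R : Finset (Fin m → ℤ)) (hR : R ⊆ intBox m q)
    (s : Fin m → ℤ) (i : Fin m) :
    (((R.filter fun a => a i + s i ∉ Finset.Ico (0 : ℤ) q).card : ℕ) : ℤ)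
      ≤ ∑ a ∈ R, |(a i + s i) / (q : ℤ)| := by
  calc (((R.filter fun a => a i + s i ∉ Finset.Ico (0 : ℤ) q).card : ℕ) : ℤ)
      = ∑ a ∈ R.filter (fun a => a i + s i ∉ Finset.Ico (0 : ℤ) q), (1 : ℤ) := by
        exact_mod_cast Finset.card_eq_sum_ones _
    _ ≤ ∑ a ∈ R.filter (fun a => a i + s i ∉ Finset.Ico (0 : ℤ) q), |(a i + s i) / (q : ℤ)| :=
        Finset.sum_le_sum fun a ha => by
          obtain ⟨haR, hx⟩ := Finset.mem_filter.1 ha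
          exact one_le_abs_ediv_of_exit q (hR haR) hx
    _ ≤ ∑ a ∈ R, |(a i + s i) / (q : ℤ)| :=
        Finset.sum_le_sum_of_subset_of_nonneg (Finset.filter_subset _ _) fun a _ _ => abs_nonneg _

/-- … and EXACTLY by them when the shift is small (`|s_i| ≤ q`):
`#{a ∈ R : a_i + s_i ∉ [0,q)} = Σ_{a ∈ R} |⌊(a_i + s_i)/q⌋|`. [folklore] -/
theorem card_coordExit_eq_sum_abs_ediv (R : Finset (Fin m → ℤ)) (hR : R ⊆ intBox m q)
    (s : Fin m → ℤ) (i : Fin m) (hs : (s i).natAbs ≤ q) :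
    (((R.filter fun a => a i + s i ∉ Finset.Ico (0 : ℤ) q).card : ℕ) : ℤ)
      = ∑ a ∈ R, |(a i + s i) / (q : ℤ)| := by
  rw [← Finset.sum_filter_add_sum_filter_not R (fun a => a i + s i ∉ Finset.Ico (0 : ℤ) q)]
  have h1 : ∑ a ∈ R.filter (fun a => a i + s i ∉ Finset.Ico (0 : ℤ) q), |(a i + s i) / (q : ℤ)|
      = ∑ a ∈ R.filter (fun a => a i + s i ∉ Finset.Ico (0 : ℤ) q), (1 : ℤ) :=
    Finset.sum_congr rfl fun a ha => by
      obtain ⟨haR, hx⟩ := Finset.mem_filter.1 ha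
      exact le_antisymm (abs_ediv_le_one_of_small q (hR haR) hs) (one_le_abs_ediv_of_exit q (hR haR) hx)
  have h2 : ∑ a ∈ R.filter (fun a => ¬ (a i + s i ∉ Finset.Ico (0 : ℤ) q)),
      |(a i + s i) / (q : ℤ)| = 0 :=
    Finset.sum_eq_zero fun a ha => by
      obtain ⟨_, hx⟩ := Finset.mem_filter.1 ha
      rw [not_not] at hx
      rw [ediv_eq_zero_of_stay q hx, abs_zero]
  rw [h1, h2, add_zero]
  exact_mod_cast Finset.card_eq_sum_ones _

/-- **The exit law, per coordinate** (census §33): for `R ⊆ [0,q)^m` mapped into itself by the wrapped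
translation by `s`, `q · #{a ∈ R : a_i + s_i ∉ [0,q)} ≤ #R · |s_i|` — with NO hypothesis on the
coordinate marginals of `R`. [folklore] -/
theorem mul_card_coordExit_le (R : Finset (Fin m → ℤ)) (hR : R ⊆ intBox m q) (s : Fin m → ℤ)
    (hwrap : ∀ a ∈ R, boxRep q (boxRed q (a + s)) ∈ R) (i : Fin m) :
    q * (R.filter fun a => a i + s i ∉ Finset.Ico (0 : ℤ) q).card ≤ R.card * (s i).natAbs := by
  have h := mul_le_mul_of_nonneg_left (card_coordExit_le_sum_abs_ediv q R hR s i)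
    (show (0 : ℤ) ≤ (q : ℤ) by positivity)
  rw [mul_sum_abs_ediv_eq q R hR s hwrap i, ← Int.natCast_natAbs] at h
  exact_mod_cast h

/-- **The exit law is exact for small shifts**: if moreover `|s_i| ≤ q`, then
`q · #{a ∈ R : a_i + s_i ∉ [0,q)} = #R · |s_i|` — the per-coordinate bound is the true exit mass.
[folklore] -/
theorem mul_card_coordExit_eq (R : Finset (Fin m → ℤ)) (hR : R ⊆ intBox m q) (s : Fin m → ℤ)
    (hwrap : ∀ a ∈ R, boxRep q (boxRed q (a + s)) ∈ R) (i : Fin m) (hs : (s i).natAbs ≤ q) :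
    q * (R.filter fun a => a i + s i ∉ Finset.Ico (0 : ℤ) q).card = R.card * (s i).natAbs := by
  have h : (q : ℤ) * (((R.filter fun a => a i + s i ∉ Finset.Ico (0 : ℤ) q).card : ℕ) : ℤ)
      = R.card * |s i| := by
    rw [card_coordExit_eq_sum_abs_ediv q R hR s i hs, mul_sum_abs_ediv_eq q R hR s hwrap i]
  rw [← Int.natCast_natAbs] at h
  exact_mod_cast h

/-- **The exit law of a wrap-invariant box set** (union bound over coordinates; census §33): for
`R ⊆ [0,q)^m` mapped into itself by the wrapped translation by `s`,
`q · #{a ∈ R : a + s ∉ [0,q)^m} ≤ #R · ‖s‖₁` — T21's `mul_card_filter_add_not_mem_intBox_le` with the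
uniform-marginals hypothesis REPLACED by wrap-invariance. [folklore] -/
theorem mul_card_filter_add_not_mem_intBox_le_of_wrap (R : Finset (Fin m → ℤ)) (hR : R ⊆ intBox m q)
    (s : Fin m → ℤ) (hwrap : ∀ a ∈ R, boxRep q (boxRed q (a + s)) ∈ R) :
    q * (R.filter fun a => a + s ∉ intBox m q).card ≤ R.card * ∑ i, (s i).natAbs := by
  have hsub : (R.filter fun a => a + s ∉ intBox m q)
      ⊆ Finset.univ.biUnion fun i => R.filter fun a => a i + s i ∉ Finset.Ico (0 : ℤ) q := by
    intro a ha
    rw [Finset.mem_filter, mem_intBox, not_forall] at ha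
    obtain ⟨haR, i, hi⟩ := ha
    exact Finset.mem_biUnion.2 ⟨i, Finset.mem_univ _, Finset.mem_filter.2 ⟨haR, hi⟩⟩
  calc q * (R.filter fun a => a + s ∉ intBox m q).card
      ≤ q * (Finset.univ.biUnion fun i => R.filter fun a => a i + s i ∉ Finset.Ico (0 : ℤ) q).card :=
        Nat.mul_le_mul_left _ (Finset.card_le_card hsub)
    _ ≤ q * ∑ i, (R.filter fun a => a i + s i ∉ Finset.Ico (0 : ℤ) q).card :=
        Nat.mul_le_mul_left _ Finset.card_biUnion_le
    _ = ∑ i, q * (R.filter fun a => a i + s i ∉ Finset.Ico (0 : ℤ) q).card := Finset.mul_sum _ _ _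
    _ ≤ ∑ i, R.card * (s i).natAbs :=
        Finset.sum_le_sum fun i _ => mul_card_coordExit_le q R hR s hwrap i
    _ = R.card * ∑ i, (s i).natAbs := (Finset.mul_sum _ _ _).symm

/-- Wrap-invariance contains T21's CLOSURE property: a plain translate that stays in the box IS the
wrapped translate, hence lies in `R`. [folklore] -/
theorem closed_of_wrap (R : Finset (Fin m → ℤ)) (s : Fin m → ℤ)
    (hwrap : ∀ a ∈ R, boxRep q (boxRed q (a + s)) ∈ R) :
    ∀ a ∈ R, a + s ∈ intBox m q → a + s ∈ R := fun a ha hbox => by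
  rw [← boxRep_boxRed q hbox]
  exact hwrap a ha

/-- **The exit probability of a wrap-invariant box set under translation** (census §33): for a non-empty
`R ⊆ [0,q)^m` mapped into itself by the wrapped translation by `s`,
`Pr_{a uniform on R}[a + s ∉ R] ≤ ‖s‖₁ / q` — T21's `exitProb_le` without the marginal and closure
hypotheses. [folklore] -/
theorem exitProb_le_of_wrap (R : Finset (Fin m → ℤ)) (hRne : R.Nonempty) (hR : R ⊆ intBox m q)
    (s : Fin m → ℤ) (hwrap : ∀ a ∈ R, boxRep q (boxRed q (a + s)) ∈ R) :
    (R.card : ℝ)⁻¹ * ((R.filter fun a => a + s ∉ R).card : ℝ) ≤ (∑ i, ((s i).natAbs : ℝ)) / q := by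
  have h := (Nat.mul_le_mul_left q
      (card_filter_add_not_mem_le_of_closed q R s (closed_of_wrap q R s hwrap))).trans
    (mul_card_filter_add_not_mem_intBox_le_of_wrap q R hR s hwrap)
  have h' : (q : ℝ) * ((R.filter fun a => a + s ∉ R).card : ℝ)
      ≤ (R.card : ℝ) * ∑ i, ((s i).natAbs : ℝ) := by
    exact_mod_cast h
  have hRpos : (0 : ℝ) < R.card := Nat.cast_pos.2 hRne.card_pos
  have hqpos : (0 : ℝ) < q := Nat.cast_pos.2 (Nat.pos_of_ne_zero (NeZero.ne q))
  rw [← div_eq_inv_mul, div_le_div_iff₀ hRpos hqpos]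
  linarith

end Exit

/-! ### C. The Step-9 register: T21 (b)–(d) with wrap-invariance in place of marginals + closure -/

section Register

variable (n : ℕ) (D p₁ Q : ℕ+) (b : Fin (n + 1) → ℤ)

/-- **T25 (a) — T21 (b) without marginals.**  Odd `P = p₁Q`, `b₀ = −1`, `2D²p₁` a unit mod `Q`, `t`
any complete residue system mod `Q`; the hidden vector `a` uniform on a non-empty `R ⊆ [0,q)^m` that is
mapped into itself by the WRAPPED translations `a ↦ (a + s_k) mod q`; the translations `a ↦ a + s_k` act
on the offset as the line translations by `p₁t_k` steps (mod `N`) and fix the side information `f` on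
`R`.  Then every digit observer reads the datum `(off a)₀ mod Q` with probability at most
`1/Q + (Σ_k ‖s_k‖₁)/(Q·q)`. [cite: ChenQuantumLattice2024, §3.5.9 pp. 35–37, §3.2 pp. 16–18;
census §26.2, §33] -/
theorem boxDigitObserver_le_of_wrap (hP : Odd ((p₁ * Q : ℕ+) : ℕ)) (hb : b 0 = -1)
    (hunit : IsUnit ((2 * D * D * p₁ : ℕ) : ZQ Q))
    (t : ZQ Q → ℤ) (ht : ∀ k, ((t k : ℤ) : ZQ Q) = k)
    {m : ℕ} {Sd : Type*} [Fintype Sd] [DecidableEq Sd]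
    (q : ℕ) [NeZero q] (R : Finset (Fin m → ℤ)) (hR : R.Nonempty) (hRbox : R ⊆ intBox m q)
    (off : (Fin m → ℤ) → Fin (n + 1) → ℤ) (s : ZQ Q → Fin m → ℤ)
    (hwrap : ∀ k, ∀ a ∈ R, boxRep q (boxRed q (a + s k)) ∈ R)
    (hoff : ∀ k, ∀ a ∈ R, ∀ i, ((off (a + s k) i : ℤ) : ZN D p₁ Q)
      = ((lineShift n D b (off a) (((p₁ : ℕ) : ℤ) * t k) i : ℤ) : ZN D p₁ Q))
    (f : (Fin m → ℤ) → Sd) (hf : ∀ k, ∀ a ∈ R, f (a + s k) = f a)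
    (g : (Fin (n + 1) → ZN D p₁ Q) × Sd → ZQ Q → ℝ)
    (hg : ∀ o a', 0 ≤ g o a') (hg1 : ∀ o, ∑ a', g o a' = 1) :
    (R.card : ℝ)⁻¹ * ∑ a ∈ R, ∑ o, digitKernel n D p₁ Q b off f a o
        * g o (toDatum D p₁ Q ((off a 0 : ℤ) : ZN D p₁ Q))
      ≤ 1 / ((Q : ℕ) : ℝ) + (∑ k, ∑ i, ((s k i).natAbs : ℝ)) / (((Q : ℕ) : ℝ) * q) := by
  have h := finsetDigitObserver_le n D p₁ Q b hP hb hunit t ht R hR off s hoff f hf g hg hg1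
  have hex : (R.card : ℝ)⁻¹ * ∑ k, ((R.filter fun a => a + s k ∉ R).card : ℝ)
      ≤ (∑ k, ∑ i, ((s k i).natAbs : ℝ)) / q := by
    rw [Finset.mul_sum, Finset.sum_div]
    exact Finset.sum_le_sum fun k _ => exitProb_le_of_wrap q R hR hRbox (s k) (hwrap k)
  have hQ : (0 : ℝ) < ((Q : ℕ) : ℝ) := by positivity
  calc _ ≤ (1 + (R.card : ℝ)⁻¹ * ∑ k, ((R.filter fun a => a + s k ∉ R).card : ℝ)) / ((Q : ℕ) : ℝ) := h
    _ ≤ (1 + (∑ k, ∑ i, ((s k i).natAbs : ℝ)) / q) / ((Q : ℕ) : ℝ) :=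
        div_le_div_of_nonneg_right (add_le_add le_rfl hex) hQ.le
    _ = 1 / ((Q : ℕ) : ℝ) + (∑ k, ∑ i, ((s k i).natAbs : ℝ)) / (((Q : ℕ) : ℝ) * q) := by
        rw [add_div, div_div, mul_comm (q : ℝ)]

/-- **T25 (b) — T21 (c) without marginals: Chen's offsets.**  Odd `P = p₁Q`, `b₀ = −1`, `2D²p₁` a unit
mod `Q`, `t` any complete residue system mod `Q`; the hidden vector `ν` uniform on a non-empty
`R ⊆ [0,q)^{n+1}` mapped into itself by the wrapped lattice translations `ν ↦ (ν − 2Dp₁t_k·b) mod q`;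
offset `v′ = D·(w₀ − ν)`; side information `f` invariant under the translations on `R`.  Then every digit
observer reads the datum `v′₀ mod Q` with probability at most `1/Q + 2Dp₁‖b‖₁(Σ_k |t_k|)/(Q·q)`.
[cite: ChenQuantumLattice2024, §3.5.9 pp. 35–37, §3.2 pp. 16–18, eq. (12) p. 17; census §26.2, §33] -/
theorem chenBoxDigitObserver_le_of_wrap (hP : Odd ((p₁ * Q : ℕ+) : ℕ)) (hb : b 0 = -1)
    (hunit : IsUnit ((2 * D * D * p₁ : ℕ) : ZQ Q))
    (t : ZQ Q → ℤ) (ht : ∀ k, ((t k : ℤ) : ZQ Q) = k)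
    {Sd : Type*} [Fintype Sd] [DecidableEq Sd]
    (q : ℕ) [NeZero q] (R : Finset (Fin (n + 1) → ℤ)) (hR : R.Nonempty)
    (hRbox : R ⊆ intBox (n + 1) q)
    (hwrap : ∀ k, ∀ ν ∈ R, boxRep q (boxRed q (ν + hiddenShift n D p₁ Q b t k)) ∈ R)
    (w₀ : Fin (n + 1) → ℤ) (f : (Fin (n + 1) → ℤ) → Sd)
    (hf : ∀ k, ∀ ν ∈ R, f (ν + hiddenShift n D p₁ Q b t k) = f ν)
    (g : (Fin (n + 1) → ZN D p₁ Q) × Sd → ZQ Q → ℝ)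
    (hg : ∀ o a', 0 ≤ g o a') (hg1 : ∀ o, ∑ a', g o a' = 1) :
    (R.card : ℝ)⁻¹ * ∑ ν ∈ R, ∑ o, digitKernel n D p₁ Q b (chenOff n D w₀) f ν o
        * g o (toDatum D p₁ Q ((chenOff n D w₀ ν 0 : ℤ) : ZN D p₁ Q))
      ≤ 1 / ((Q : ℕ) : ℝ) + 2 * ((D : ℕ) : ℝ) * ((p₁ : ℕ) : ℝ) * (∑ i, ((b i).natAbs : ℝ))
          * (∑ k, ((t k).natAbs : ℝ)) / (((Q : ℕ) : ℝ) * q) := by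
  have h := boxDigitObserver_le_of_wrap n D p₁ Q b hP hb hunit t ht q R hR hRbox (chenOff n D w₀)
    (hiddenShift n D p₁ Q b t) hwrap
    (fun k ν _ i => by rw [chenOff_add_hiddenShift]) f hf g hg hg1
  rwa [sum_natAbs_hiddenShift] at h

/-- **T25 (c) — T21 (d) without marginals: the centred residue system.**  With `t_k` the centred lift
(`Σ_k |t_k| = (Q² − 1)/4` for odd `Q`) the bound of (b) reads `1/Q + Dp₁(Q² − 1)‖b‖₁/(2Qq)` — the
census's `1/C + W`, `W ≤ Dp₁(C² − 1)‖b‖₁/(2Cq)` (this module's `Q` is the census's `C`), for EVERY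
wrap-invariant `R`. [cite: ChenQuantumLattice2024, §3.5.9 pp. 35–37; census §26.2 (iii), §33] -/
theorem chenBoxDigitObserver_le_centred_of_wrap (hP : Odd ((p₁ * Q : ℕ+) : ℕ)) (hb : b 0 = -1)
    (hunit : IsUnit ((2 * D * D * p₁ : ℕ) : ZQ Q))
    {Sd : Type*} [Fintype Sd] [DecidableEq Sd]
    (q : ℕ) [NeZero q] (R : Finset (Fin (n + 1) → ℤ)) (hR : R.Nonempty)
    (hRbox : R ⊆ intBox (n + 1) q)
    (hwrap : ∀ k, ∀ ν ∈ R,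
      boxRep q (boxRed q (ν + hiddenShift n D p₁ Q b (fun k => k.valMinAbs) k)) ∈ R)
    (w₀ : Fin (n + 1) → ℤ) (f : (Fin (n + 1) → ℤ) → Sd)
    (hf : ∀ k, ∀ ν ∈ R, f (ν + hiddenShift n D p₁ Q b (fun k => k.valMinAbs) k) = f ν)
    (g : (Fin (n + 1) → ZN D p₁ Q) × Sd → ZQ Q → ℝ)
    (hg : ∀ o a', 0 ≤ g o a') (hg1 : ∀ o, ∑ a', g o a' = 1) :
    (R.card : ℝ)⁻¹ * ∑ ν ∈ R, ∑ o, digitKernel n D p₁ Q b (chenOff n D w₀) f ν o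
        * g o (toDatum D p₁ Q ((chenOff n D w₀ ν 0 : ℤ) : ZN D p₁ Q))
      ≤ 1 / ((Q : ℕ) : ℝ) + ((D : ℕ) : ℝ) * ((p₁ : ℕ) : ℝ) * (((Q : ℕ) : ℝ) ^ 2 - 1)
          * (∑ i, ((b i).natAbs : ℝ)) / (2 * ((Q : ℕ) : ℝ) * q) := by
  have hQodd : Odd ((Q : ℕ+) : ℕ) := (Nat.odd_mul.1 (by simpa [PNat.mul_coe] using hP)).2
  have h := chenBoxDigitObserver_le_of_wrap n D p₁ Q b hP hb hunit (fun k => k.valMinAbs)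
    (fun k => ZMod.coe_valMinAbs k) q R hR hRbox hwrap w₀ f hf g hg hg1
  beta_reduce at h
  rw [sum_natAbs_valMinAbs_real _ hQodd] at h
  refine h.trans (le_of_eq ?_)
  have hQ : (((Q : ℕ+) : ℕ) : ℝ) ≠ 0 := by positivity
  have hq' : (q : ℝ) ≠ 0 := by exact_mod_cast NeZero.ne q
  field_simp
  ring

end Register

/-! ### D. Parity-check boxes are wrap-invariant: T21 (e) on EVERY parity-check box -/

section CheckBox

variable {m : ℕ} {ι : Type*} [Fintype ι] (q : ℕ) [NeZero q] (κ : ι → ((Fin m → ℤ) →+ ZMod q))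

/-- **Parity-check boxes are wrap-invariant.**  The wrapped translate of a point of the parity-check box
`L_q^⊥(A) ∩ [0,q)^m` by ANY vector annihilated by the checks (any vector of `L_q^⊥(A)`, e.g. any integer
multiple of Chen's `b`) is again a point of the parity-check box: an additive check into `ℤ_q` only sees
residues. [cite: ChenQuantumLattice2024, §3.2 pp. 16–18, eq. (12) p. 17] -/
theorem boxRep_boxRed_add_mem_checkBox (s : Fin m → ℤ) (hs : ∀ j, κ j s = 0) :
    ∀ a ∈ checkBox q κ, boxRep q (boxRed q (a + s)) ∈ checkBox q κ := by
  intro a ha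
  rw [checkBox, Finset.mem_filter] at ha ⊢
  refine ⟨boxRep_mem_intBox q _, fun j => ?_⟩
  rw [apply_eq_of_boxRed_eq q (κ j) (boxRed_boxRep q (boxRed q (a + s))), map_add, ha.2 j, hs j,
    add_zero]

/-- **The exit law of a parity-check box**: for EVERY family of checks and every annihilated `s`,
`q · #{a ∈ L_q^⊥(A) ∩ [0,q)^m : a + s ∉ [0,q)^m} ≤ #(L_q^⊥(A) ∩ [0,q)^m) · ‖s‖₁` — no marginal, rank or
generation hypothesis. [cite: ChenQuantumLattice2024, §3.2 pp. 16–18; census §33] -/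
theorem mul_card_checkBox_exit_le (s : Fin m → ℤ) (hs : ∀ j, κ j s = 0) :
    q * ((checkBox q κ).filter fun a => a + s ∉ intBox m q).card
      ≤ (checkBox q κ).card * ∑ i, (s i).natAbs :=
  mul_card_filter_add_not_mem_intBox_le_of_wrap q (checkBox q κ) (checkBox_subset_intBox q κ) s
    (boxRep_boxRed_add_mem_checkBox q κ s hs)

end CheckBox

section ChenCheckBox

variable (n : ℕ) (D p₁ Q : ℕ+) (b : Fin (n + 1) → ℤ)

/-- **T25 — the box-wrap bound on EVERY parity-check box (T21 (e) with its marginal hypothesis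
REMOVED).**  Odd `P = p₁Q`, `b₀ = −1`, `2D²p₁` a unit mod `Q`; ANY modulus `q ≥ 1` and ANY family `κ` of
additive checks into `ℤ_q` annihilating the secret `b` (`b ∈ L_q^⊥(A)`, eq. (12)); the hidden vector `ν`
uniform on the parity-check box `R = L_q^⊥(A) ∩ [0,q)^{n+1}`; offset `v′ = D·(w₀ − ν)`; side
information invariant under `ν ↦ ν − 2Dp₁t_k·b` on `R` (centred `t_k`).  Then every digit observer reads
the datum with probability at most `1/Q + Dp₁(Q² − 1)‖b‖₁/(2Qq)` — the statement of
`chenCheckBoxDigitObserver_le_centred` (T21 (e)) verbatim WITHOUT `hmarg`; in particular for instances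
whose coordinate marginals are NOT uniform (T23's criterion fails; T24's exceptional set).
[cite: ChenQuantumLattice2024, §3.5.9 pp. 35–37, §3.2 pp. 16–18, eq. (12) p. 17; census §26.2, §33] -/
theorem chenCheckBoxDigitObserver_le_centred_all (hP : Odd ((p₁ * Q : ℕ+) : ℕ)) (hb : b 0 = -1)
    (hunit : IsUnit ((2 * D * D * p₁ : ℕ) : ZQ Q))
    {Sd ι : Type*} [Fintype Sd] [DecidableEq Sd] [Fintype ι]
    (q : ℕ) (hq : 0 < q) (κ : ι → ((Fin (n + 1) → ℤ) →+ ZMod q)) (hbκ : ∀ j, κ j b = 0)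
    (w₀ : Fin (n + 1) → ℤ) (f : (Fin (n + 1) → ℤ) → Sd)
    (hf : ∀ k, ∀ ν ∈ checkBox q κ, f (ν + hiddenShift n D p₁ Q b (fun k => k.valMinAbs) k) = f ν)
    (g : (Fin (n + 1) → ZN D p₁ Q) × Sd → ZQ Q → ℝ)
    (hg : ∀ o a', 0 ≤ g o a') (hg1 : ∀ o, ∑ a', g o a' = 1) :
    ((checkBox q κ).card : ℝ)⁻¹ * ∑ ν ∈ checkBox q κ, ∑ o, digitKernel n D p₁ Q b (chenOff n D w₀) f ν o
        * g o (toDatum D p₁ Q ((chenOff n D w₀ ν 0 : ℤ) : ZN D p₁ Q))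
      ≤ 1 / ((Q : ℕ) : ℝ) + ((D : ℕ) : ℝ) * ((p₁ : ℕ) : ℝ) * (((Q : ℕ) : ℝ) ^ 2 - 1)
          * (∑ i, ((b i).natAbs : ℝ)) / (2 * ((Q : ℕ) : ℝ) * q) := by
  haveI : NeZero q := ⟨hq.ne'⟩
  exact chenBoxDigitObserver_le_centred_of_wrap n D p₁ Q b hP hb hunit q (checkBox q κ)
    (checkBox_nonempty q κ hq) (checkBox_subset_intBox q κ)
    (fun k => by
      rw [hiddenShift_eq_zsmul]
      exact boxRep_boxRed_add_mem_checkBox q κ _ (checks_zsmul q κ b hbκ _))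
    w₀ f hf g hg hg1

/-- **T25 (Chen form) — the box-wrap bound for Chen's systematic instances `A = [2p₁t | Uᵀ | I_m]`,
with NO hypothesis on the rows.**  T23's `chenSysCheckBoxDigitObserver_le_centred` without `hτ` and
`hrow`, T24's `chenSysCheckBoxDigitObserver_le_centred_of_block` without `e`, `he`, `hV`: pivots `τ` and
free data `M` arbitrary, `b` annihilated by the checks (`Ab ≡ 0 (mod q)`, eq. (12)); every digit
observer reads the datum with probability at most `1/Q + Dp₁(Q² − 1)‖b‖₁/(2Qq)` — on EVERY instance,
the exceptional ones (some row of `[2p₁t | Uᵀ]` inside a proper ideal of `ℤ_q`) included.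
[cite: ChenQuantumLattice2024, §3.5.9 pp. 35–37, §3.2 pp. 16–18, eq. (12) p. 17, §3.3 p. 18;
census §26.2, §31, §32, §33] -/
theorem chenSysCheckBoxDigitObserver_le_centred_all (hP : Odd ((p₁ * Q : ℕ+) : ℕ)) (hb : b 0 = -1)
    (hunit : IsUnit ((2 * D * D * p₁ : ℕ) : ZQ Q))
    {Sd ι : Type*} [Fintype Sd] [DecidableEq Sd] [Fintype ι]
    (q : ℕ) [NeZero q] (τ : ι → Fin (n + 1)) (M : ι → Fin (n + 1) → ZMod q)
    (hbκ : ∀ j, sysCheck q τ M j b = 0)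
    (w₀ : Fin (n + 1) → ℤ) (f : (Fin (n + 1) → ℤ) → Sd)
    (hf : ∀ k, ∀ ν ∈ checkBox q (sysCheck q τ M),
      f (ν + hiddenShift n D p₁ Q b (fun k => k.valMinAbs) k) = f ν)
    (g : (Fin (n + 1) → ZN D p₁ Q) × Sd → ZQ Q → ℝ)
    (hg : ∀ o a', 0 ≤ g o a') (hg1 : ∀ o, ∑ a', g o a' = 1) :
    ((checkBox q (sysCheck q τ M)).card : ℝ)⁻¹
        * ∑ ν ∈ checkBox q (sysCheck q τ M), ∑ o, digitKernel n D p₁ Q b (chenOff n D w₀) f ν o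
          * g o (toDatum D p₁ Q ((chenOff n D w₀ ν 0 : ℤ) : ZN D p₁ Q))
      ≤ 1 / ((Q : ℕ) : ℝ) + ((D : ℕ) : ℝ) * ((p₁ : ℕ) : ℝ) * (((Q : ℕ) : ℝ) ^ 2 - 1)
          * (∑ i, ((b i).natAbs : ℝ)) / (2 * ((Q : ℕ) : ℝ) * q) :=
  chenCheckBoxDigitObserver_le_centred_all n D p₁ Q b hP hb hunit q (Nat.pos_of_ne_zero (NeZero.ne q))
    (sysCheck q τ M) hbκ w₀ f hf g hg hg1

end ChenCheckBox

end Literature.Computability.Cryptography.Chen2024
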